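import Mathlib.Algebra.MvPolynomial.Eval
import Mathlib.LinearAlgebra.Dual.Lemmas
import Mathlib.RingTheory.MvPolynomial.Basic
import HarnessLib

/-!
# GAP-2 «k ≠ k̄» engine: divisibility and primality in `k[X]` DESCEND along any field extension `K ⊇ k`
# (crux `FInjectiveMacaulayfication` stmt-ResolutionOfSingularities-15315, chain w45a; seat res-L1-w45a-stub-2 g12; serves the any-field twins of the Brieskorn–Pham / diagonal family
# rows, whose primality witness `ω^{a} = −1` so far had to live in `k = k̄`)

[OURS · L1 W4.5a] Support file (`--supports stmt-ResolutionOfSingularities-15315 --as helper`); def-free; UNCONDITIONAL; pure commutative algebra, no named fact; NOT a statement of any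
manuscript. AI-written (AI review is weaker than expert review). Nothing of the crux is proved here.

THE POINT. The census-family Specimen files (`BrieskornPhamSpecimen.prime_f … ω hω`) prove primality of `z^c + Σ xⱼ^{aⱼ}` from a root `ω` of `ω^{a₁} = −1`, which exists over an
algebraically closed field; to state those rows over an ARBITRARY field of characteristic `p` one proves primality over `K := AlgebraicClosure k` and DESCENDS it. Descent of
divisibility along `map (algebraMap k K) : k[X] → K[X]` is elementary: pick a `k`-linear functional `λ : K → k` with `λ 1 = 1` (`Module.Projective.exists_dual_eq_one`) and apply it
coefficientwise — this is `k[X]`-linear for products with polynomials coming from `k`, and retracts `map`.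
* §1 `exists_dual_apply_one` — a `k`-linear `λ : K → k` with `λ 1 = 1`;
* §2 `coeff_mapRange_dual`, `mapRange_dual_map` (retraction), `mapRange_dual_map_mul` (`λ_*(map f · h) = f · λ_* h`);
* §3 ★ `dvd_of_map_dvd_map` — `map f ∣ map g` in `K[X]` ⇒ `f ∣ g` in `k[X]`; ★ `prime_of_prime_map` — `map f` prime in `K[X]` ⇒ `f` prime in `k[X]`;
  `mk_X_ne_zero_of_map` — `x̄ᵥ ≠ 0` in `K[X]/(map f)` ⇒ `x̄ᵥ ≠ 0` in `k[X]/(f)`.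
[cite: Matsumura1987, Thm. 7.5 (faithful flatness of field base change — the conceptual reason; the proof here is the elementary coefficient retraction)]
-/

-- single-problem summit: the doubled namespace component is forced
set_option linter.dupNamespace false

noncomputable section

open MvPolynomial

namespace Summit.ResolutionOfSingularities.ResolutionOfSingularities.Theorems.FInjectiveMacaulayfication.PrimeDescentFieldExtension

variable {k K : Type} [Field k] [Field K] [Algebra k K] {σ : Type}

/-! ## §1 A `k`-linear retraction of `K` onto `k` -/

/-- Over a field, every extension field `K ⊇ k` carries a `k`-linear functional `λ : K → k` with `λ 1 = 1` (`K` is a free, hence projective, `k`-module and `1 ≠ 0`).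
[folklore; Mathlib `Module.Projective.exists_dual_eq_one`] -/
theorem exists_dual_apply_one : ∃ l : K →ₗ[k] k, l 1 = 1 :=
  Module.Projective.exists_dual_eq_one k (one_ne_zero : (1 : K) ≠ 0)

/-! ## §2 Coefficientwise application of a functional -/

/-- Coefficients of the coefficientwise image `λ_* q := .ofCoeff (mapRange λ (coeff q))`. [plumbing] -/
theorem coeff_mapRange_dual (l : K →ₗ[k] k) (q : MvPolynomial σ K) (m : σ →₀ ℕ) :
    coeff m (AddMonoidAlgebra.ofCoeff (Finsupp.mapRange (fun c : K => l c) (map_zero l) (AddMonoidAlgebra.coeff q)) : MvPolynomial σ k) =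
      l (coeff m q) :=
  Finsupp.mapRange_apply (hf := map_zero l)

/-- `λ_*` retracts `map (algebraMap k K)` when `λ 1 = 1`. [plumbing] -/
theorem mapRange_dual_map (l : K →ₗ[k] k) (hl : l 1 = 1) (g : MvPolynomial σ k) :
    (AddMonoidAlgebra.ofCoeff (Finsupp.mapRange (fun c : K => l c) (map_zero l) (AddMonoidAlgebra.coeff (map (algebraMap k K) g))) : MvPolynomial σ k) = g := by
  refine MvPolynomial.ext _ _ fun m => ?_
  rw [coeff_mapRange_dual, coeff_map, Algebra.algebraMap_eq_smul_one, map_smul, hl, smul_eq_mul, mul_one]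

/-- `λ_*` is `k[X]`-linear for products with polynomials from `k`: `λ_*(map f · h) = f · λ_* h`. [plumbing] -/
theorem mapRange_dual_map_mul (l : K →ₗ[k] k) (f : MvPolynomial σ k) (h : MvPolynomial σ K) :
    (AddMonoidAlgebra.ofCoeff (Finsupp.mapRange (fun c : K => l c) (map_zero l) (AddMonoidAlgebra.coeff (map (algebraMap k K) f * h))) : MvPolynomial σ k) =
      f * (AddMonoidAlgebra.ofCoeff (Finsupp.mapRange (fun c : K => l c) (map_zero l) (AddMonoidAlgebra.coeff h)) : MvPolynomial σ k) := by
  classical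
  refine MvPolynomial.ext _ _ fun m => ?_
  rw [coeff_mapRange_dual, coeff_mul, coeff_mul, map_sum]
  refine Finset.sum_congr rfl fun x _ => ?_
  rw [coeff_map, coeff_mapRange_dual, Algebra.algebraMap_eq_smul_one, smul_mul_assoc, one_mul, map_smul, smul_eq_mul]

/-! ## §3 ★ Descent of divisibility and primality -/

/-- ★ **DIVISIBILITY DESCENDS ALONG FIELD EXTENSIONS**: for `f, g ∈ k[X]`, `map f ∣ map g` in `K[X]` implies `f ∣ g` in `k[X]`. [folklore; cite: Matsumura1987, Thm. 7.5] -/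
theorem dvd_of_map_dvd_map (f g : MvPolynomial σ k) (h : map (algebraMap k K) f ∣ map (algebraMap k K) g) : f ∣ g := by
  obtain ⟨l, hl⟩ := (exists_dual_apply_one : ∃ l : K →ₗ[k] k, l 1 = 1)
  obtain ⟨q, hq⟩ := h
  refine ⟨(AddMonoidAlgebra.ofCoeff (Finsupp.mapRange (fun c : K => l c) (map_zero l) (AddMonoidAlgebra.coeff q)) : MvPolynomial σ k), ?_⟩
  have e := congrArg (fun r : MvPolynomial σ K =>
    (AddMonoidAlgebra.ofCoeff (Finsupp.mapRange (fun c : K => l c) (map_zero l) (AddMonoidAlgebra.coeff r)) : MvPolynomial σ k)) hq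
  rw [mapRange_dual_map l hl, mapRange_dual_map_mul] at e
  exact e

/-- ★ **PRIMALITY DESCENDS ALONG FIELD EXTENSIONS**: if `map (algebraMap k K) f` is prime in `K[X]`, then `f` is prime in `k[X]`. [folklore; cite: Matsumura1987, Thm. 7.5] -/
theorem prime_of_prime_map (f : MvPolynomial σ k) (h : Prime (map (algebraMap k K) f)) : Prime f := by
  refine ⟨fun h0 => h.ne_zero (by rw [h0, map_zero]), fun hu => h.not_unit (hu.map (map (algebraMap k K))), fun a b hab => ?_⟩
  have hab' : map (algebraMap k K) f ∣ map (algebraMap k K) a * map (algebraMap k K) b := by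
    rw [← map_mul]
    exact map_dvd (map (algebraMap k K)) hab
  rcases h.dvd_or_dvd hab' with h1 | h2
  · exact Or.inl (dvd_of_map_dvd_map f a h1)
  · exact Or.inr (dvd_of_map_dvd_map f b h2)

/-- **`x̄ᵥ ≠ 0` DESCENDS**: if the class of `Xᵥ` is non-zero in `K[X]/(map f)`, it is non-zero in `k[X]/(f)` (divisibility ASCENDS trivially). [plumbing] -/
theorem mk_X_ne_zero_of_map (f : MvPolynomial σ k) (v : σ)
    (h : Ideal.Quotient.mk (Ideal.span {map (algebraMap k K) f}) (X v) ≠ 0) :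
    Ideal.Quotient.mk (Ideal.span {f}) (X v) ≠ 0 := by
  intro h0
  apply h
  rw [Ideal.Quotient.eq_zero_iff_mem, Ideal.mem_span_singleton] at h0 ⊢
  have := map_dvd (map (algebraMap k K)) h0
  rwa [map_X] at this

end Summit.ResolutionOfSingularities.ResolutionOfSingularities.Theorems.FInjectiveMacaulayfication.PrimeDescentFieldExtension

end
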